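import Summits.QuantumFields.YangMills.Theorems.LuscherReductionTwistedTraceScalingCoarseLower
import Summits.QuantumFields.YangMills.Theorems.LuscherReductionTwistedTraceScalingBaseOne
import HarnessLib

/-!
# S-BASE ⟸ THE LATTICE WINDOW FLOOR ALONE: with COARSE-UPPER(L) (✓`coarseUpper`) and COARSE-LOWER(L) (✓`coarseLower`) in the tree for every `L ≥ 2` and the `L = 1` instance closed
# (✓`…BaseOne`), the registered stub `stub_fixedLatticeTraceLaw` of line «twolattice» reduces to ONE named `k`-uniform statement per lattice size, W(L)
# (lane A of S-BASE, crux `TwistedTraceScaling` stmt-QuantumFields-20203; lead g23; `HANDOFF-g23.md` «WHAT IS LEFT OF S-BASE = W(L) ONLY»)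

* `coarseUpper_all`, `coarseLower_all` — the hypotheses `hUp`, `hLow` of ✓`Base.stmt_of_coarse` at EVERY lattice size (`L₁ = 1`: ✓`coarseUpper_one` ∕ ✓`coarseLower_one`; `L₁ ≥ 2`:
  ✓`ConstTube.coarseUpper` ∕ ✓`ConstTube.coarseLower`);
* ★ `fixedLatticeTraceLaw_of_window (hL2 : 2 ≤ L) (hW : W(L))` — S-BASE at lattice size `L` from the window floor W(L) alone (✓`fixedLatticeTraceLaw_of_upper_lower_window`);
* ★★ `stmt_of_window (hW : ∀ L₁ ≥ 2, W(L₁))` — conclusion = VERBATIM the body of the registered `TwoLattice.Stmt.stub_fixedLatticeTraceLaw` (as in ✓`Base.stmt_of_coarse`): the stub is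
  CLOSED MODULO the lattice window floor
  `W(L₁) : ∀ c₁ > 0, ∃ g ≥ 0, (∀ t > 0, Summable (e^{−t·g k})) ∧ ∃ β₀, ∀ β ≥ β₀, ∀ k, λ_k(β, L₁) ≤ exp(−(Λ(β,L₁)/L₁)·min (g k) (c₁ log β))·λ₀(β, L₁)` for `L₁ ≥ 2`
  (the lattice twin of the closed child's ✓`OST.windowFloor_all`; `k`-UNIFORM, hence not a corollary of the per-level comparisons BO_up ∕ BO_lower).
HONEST FRAMING: glue only; W(L) for `L ≥ 2` is OPEN and crux-sized; `stub_cmpTwoLoop` and the crux `TwistedTraceScaling` stay OPEN; CONDITIONAL route R2b1 (Lüscher two-lattice reduction);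
not infinite volume, not a mass gap, not Clay.  No named facts, no `sorry`.
-/

set_option autoImplicit false

noncomputable section

open MeasureTheory Filter Topology Real
open scoped BigOperators
open Literature.MathematicalPhysics.QuantumFieldTheory
open Literature.MathematicalPhysics.QuantumLattice

namespace Summit.QuantumFields.YangMills.Theorems.FemtoTransferGap.TwoLattice.Base

open Summit.QuantumFields.YangMills.Theorems.FemtoTransferGap
open Summit.QuantumFields.YangMills.Theorems.FemtoTransferGap.TraceDoor

/-- **COARSE-UPPER at every lattice size** (`L₁ = 1`: ✓`coarseUpper_one`; `L₁ ≥ 2`: ✓`ConstTube.coarseUpper`). [cite: Luscher1983, §3] -/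
theorem coarseUpper_all (L1 : ℕ) [NeZero L1] :
    ∀ k : ℕ, ∀ d : ℝ, d < levelGap k → ∃ lam0 : ℝ, 0 < lam0 ∧ ∀ lam : ℝ, 0 < lam → lam ≤ lam0 →
      ∀ β : ℝ, InFemtoWindow lam β L1 →
        levelValue su2Rep L1 β k ≤ Real.exp (-(d * luscherLambda β L1) / L1) * levelValue su2Rep L1 β 0 := by
  rcases Nat.lt_or_ge L1 2 with h | h
  · have h1 : L1 = 1 := by have := NeZero.ne L1; omega
    subst h1
    exact coarseUpper_one
  · exact ConstTube.coarseUpper h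

/-- **COARSE-LOWER at every lattice size** (`L₁ = 1`: ✓`coarseLower_one`; `L₁ ≥ 2`: ✓`ConstTube.coarseLower`). [cite: Luscher1983, §3] -/
theorem coarseLower_all (L1 : ℕ) [NeZero L1] :
    ∀ k : ℕ, ∀ ε : ℝ, 0 < ε → ∃ lam0 : ℝ, 0 < lam0 ∧ ∀ lam : ℝ, 0 < lam → lam ≤ lam0 →
      ∀ β : ℝ, InFemtoWindow lam β L1 →
        Real.exp (-((levelGap k + ε) * luscherLambda β L1) / L1) * levelValue su2Rep L1 β 0 ≤ levelValue su2Rep L1 β k := by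
  rcases Nat.lt_or_ge L1 2 with h | h
  · have h1 : L1 = 1 := by have := NeZero.ne L1; omega
    subst h1
    exact coarseLower_one
  · exact ConstTube.coarseLower h

/-- ★ **S-BASE at lattice size `L ≥ 2` from the window floor W(L) alone.** [cite: Luscher1983, §3] [cite: MontvayMunster1994, (3.145)] -/
theorem fixedLatticeTraceLaw_of_window (L : ℕ) [NeZero L] (hL2 : 2 ≤ L)
    (hW : ∀ c₁ : ℝ, 0 < c₁ → ∃ g : ℕ → ℝ, (∀ k, 0 ≤ g k) ∧
      (∀ t : ℝ, 0 < t → Summable fun k : ℕ => Real.exp (-t * g k)) ∧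
      ∃ β0 : ℝ, ∀ β : ℝ, β0 ≤ β → ∀ k : ℕ,
        levelValue su2Rep L β k ≤
          Real.exp (-(luscherLambda β L / L * min (g k) (c₁ * Real.log β))) * levelValue su2Rep L β 0) :
    ∀ s : ℝ, 0 < s → ∀ ε : ℝ, 0 < ε → ∃ β1 : ℝ, ∀ β : ℝ, β1 ≤ β →
      |traceRatio L β (femtoSteps s β L) - hTraceRatio s| ≤ ε :=
  fixedLatticeTraceLaw_of_upper_lower_window L (ConstTube.coarseUpper hL2) (ConstTube.coarseLower hL2) hW

/-- ★★ **THE REGISTERED STUB MODULO THE LATTICE WINDOW FLOOR**: if W(L₁) holds for every `L₁ ≥ 2`, then (VERBATIM the body of `TwoLattice.Stmt.stub_fixedLatticeTraceLaw`)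
`∀ L₁ s > 0 ε > 0, ∃ β₁, ∀ β ≥ β₁, |traceRatio L₁ β (femtoSteps s β L₁) − hTraceRatio s| ≤ ε`. [cite: Luscher1983, §3] [cite: MontvayMunster1994, (3.145)] -/
theorem stmt_of_window
    (hW : ∀ (L1 : ℕ) [NeZero L1], 2 ≤ L1 → ∀ c₁ : ℝ, 0 < c₁ → ∃ g : ℕ → ℝ, (∀ k, 0 ≤ g k) ∧
      (∀ t : ℝ, 0 < t → Summable fun k : ℕ => Real.exp (-t * g k)) ∧
      ∃ β0 : ℝ, ∀ β : ℝ, β0 ≤ β → ∀ k : ℕ,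
        levelValue su2Rep L1 β k ≤
          Real.exp (-(luscherLambda β L1 / L1 * min (g k) (c₁ * Real.log β))) * levelValue su2Rep L1 β 0) :
    ∀ (L1 : ℕ) [NeZero L1] (s : ℝ), 0 < s → ∀ ε : ℝ, 0 < ε → ∃ β1 : ℝ, ∀ β : ℝ, β1 ≤ β →
      |traceRatio L1 β (femtoSteps s β L1) - hTraceRatio s| ≤ ε := by
  intro L1 _ s hs ε hε
  rcases Nat.lt_or_ge L1 2 with h | h
  · have h1 : L1 = 1 := by have := NeZero.ne L1; omega
    subst h1
    exact fixedLatticeTraceLaw_one s hs ε hε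
  · exact fixedLatticeTraceLaw_of_window L1 h (hW L1 h) s hs ε hε

end Summit.QuantumFields.YangMills.Theorems.FemtoTransferGap.TwoLattice.Base

end
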